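import Summits.Parity.GeneralizedHardyLittlewood.Theorems.GreenTaoLevelTwoMNTwoRecurrentLinear
import Summits.Parity.GeneralizedHardyLittlewood.Theorems.GreenTaoLevelTwoMNTwoRecurrentLinearTiny

/-!
# Route `GreenTaoLevelTwo`, crux `MNTwo` (stmt-Parity-21276), line `birth`, stub `stub_mnVertical`:
# recurrent linear functions are major arc, amplified form (GT 2008b App. A, Lemma 32 (ii))

Tool for blocks V4–V5 of the `stub_mnVertical` census (B. Green, T. Tao, *Quadratic uniformity of
the Möbius function*, Ann. Inst. Fourier 58 (2008) = arXiv:math/0606087, Appendix A, Lemma 32 (ii):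
"If `|I| > 2/δ₂²`, then `‖α‖_{ℝ/ℤ,16/δ₂²} ≤ 2¹⁵δ₁/(δ₂⁶|I|)`" — "We now use a standard “amplification”
argument … there exists some `b` such that the set `𝔏_b := {b+1,…,b+m} ∩ 𝔏` has cardinality at least
`δ₂m/2` … if `x = ml + l'` with `l ∈ 𝔏` and `l' ∈ 𝔏_b`, then `‖αx‖ ≤ 2mδ₁` … `|m𝔏 + 𝔏_b| ≥ δ₂²mL/2`
… apply (i) with `I`, `δ₁`, `δ₂` replaced by `I'`, `2mδ₁`, `δ₂²/2` … `m := ⌊δ₂²/16δ₁⌋`").  We follow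
the printed amplification in the regime `1/(8|I|) < δ₁ < δ₂²/64` (where the block length
`m = ⌊δ₂²/(32δ₁)⌋` satisfies `2 ≤ m ≤ |I|`, a condition the print leaves implicit), use part (i)
(`…MNTwoRecurrentLinear`) directly when `δ₁ ≥ δ₂²/64`, and the fine-scale lattice argument
(`…MNTwoRecurrentLinearTiny`) when `δ₁ ≤ 1/(8|I|)`.  Constants: `q ≤ 6418/δ₂²`,
`‖qα‖ ≤ 2630455808·δ₁/(δ₂⁶|I|)`.  Def-free.

* `exists_dense_block` — pigeonholing a dense subset of `{1,…,L}` onto a block of length `m ≤ L`;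
* `card_filter_amplified_ge` — the amplified interval `{1,…,mL}` carries `≥ #𝔏 · #𝔏_b` points with
  `‖α(M₀ + l)‖ ≤ 2mδ₁`;
* `exists_norm_mul_le_of_many_small_amplified` — **Lemma 32 (ii)**.

References: [GreenTao2008QuadraticMobius] arXiv:math/0606087 App. A, Lemma 32 (ii).
-/

noncomputable section

open Finset Real

namespace Summit.Parity.GeneralizedHardyLittlewood.GreenTaoLevelTwoMNTwoRecurrentLinearAmplified

open Summit.Parity.GeneralizedHardyLittlewood.GreenTaoLevelTwoMNTwoRecurrentLinear
  (exists_norm_mul_le_of_many_small)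
open Summit.Parity.GeneralizedHardyLittlewood.GreenTaoLevelTwoMNTwoRecurrentLinearTiny
  (exists_norm_mul_le_of_many_tiny)

/-- **Pigeonholing onto a block.**  If `A ⊆ {1,…,L}` and `1 ≤ m ≤ L`, some block
`{jm+1, …, jm+m}` contains at least `#A · m/(2L)` elements of `A`. [folklore] -/
theorem exists_dense_block {L m : ℕ} (hm : 1 ≤ m) (hmL : m ≤ L) (A : Finset ℕ)
    (hA : A ⊆ Icc 1 L) :
    ∃ j : ℕ, (#A : ℝ) * m / (2 * L) ≤ #(A.filter fun l : ℕ => (l - 1) / m = j) := by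
  classical
  have hLpos : (0 : ℝ) < L := by exact_mod_cast (show 0 < L by omega)
  have hmpos : (0 : ℝ) < m := by exact_mod_cast (show 0 < m by omega)
  set J : ℕ := L / m + 1 with hJ
  have hmaps : ∀ l ∈ A, (l - 1) / m ∈ range J := by
    intro l hl
    have h := mem_Icc.1 (hA hl)
    rw [mem_range, hJ]
    have : (l - 1) / m ≤ L / m := Nat.div_le_div_right (by omega)
    omega
  have hsum : #A = ∑ j ∈ range J, #(A.filter fun l : ℕ => (l - 1) / m = j) :=
    card_eq_sum_card_fiberwise hmaps
  -- `J ≤ 2L/m`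
  have hJle : (J : ℝ) ≤ 2 * L / m := by
    rw [hJ, le_div_iff₀ hmpos]
    push_cast
    have h1 : ((L / m : ℕ) : ℝ) * m ≤ L := by exact_mod_cast Nat.div_mul_le_self L m
    have h2 : (m : ℝ) ≤ L := by exact_mod_cast hmL
    nlinarith
  by_contra hcon
  push Not at hcon
  have hlt : ((#A : ℕ) : ℝ) < J * ((#A : ℝ) * m / (2 * L)) := by
    calc ((#A : ℕ) : ℝ) = ∑ j ∈ range J, (#(A.filter fun l : ℕ => (l - 1) / m = j) : ℝ) := by
          rw [hsum]; push_cast; rfl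
      _ < ∑ _j ∈ range J, (#A : ℝ) * m / (2 * L) :=
          sum_lt_sum_of_nonempty ⟨0, mem_range.2 (Nat.succ_pos _)⟩ fun j _ => hcon j
      _ = J * ((#A : ℝ) * m / (2 * L)) := by rw [sum_const, card_range, nsmul_eq_mul]
  have hA0 : (0 : ℝ) ≤ #A := Nat.cast_nonneg _
  have : (J : ℝ) * ((#A : ℝ) * m / (2 * L)) ≤ #A := by
    calc (J : ℝ) * ((#A : ℝ) * m / (2 * L)) ≤ (2 * L / m) * ((#A : ℝ) * m / (2 * L)) :=
          mul_le_mul_of_nonneg_right hJle (by positivity)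
      _ = #A := by field_simp
  linarith

/-- **The amplified interval.**  Let `A ⊆ {1,…,L}` consist of `l` with `‖α(M+l)‖_{ℝ/ℤ} ≤ δ₁`, let
`m ≥ 1`, `j`, and `A_j := {l' ∈ A : (l'−1)/m = j}` (the elements of `A` in the block
`{jm+1,…,jm+m}`).  Then at least `#A · #A_j` integers `l'' ∈ {1, …, mL}` satisfy
`‖α(M₀ + l'')‖_{ℝ/ℤ} ≤ 2mδ₁`, where `M₀ = (m+1)M + m(j+1)` (namely `l'' = m(l−1) + (l'−jm)`,
for which `M₀ + l'' = m(M+l) + (M+l')`).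
[cite: GreenTao2008QuadraticMobius, proof of Lemma 32 (ii)] -/
theorem card_filter_amplified_ge (α : ℝ) (M : ℤ) {L m : ℕ} (hm : 1 ≤ m) {δ₁ : ℝ} (j : ℕ)
    (A : Finset ℕ) (hA : ∀ l ∈ A, (1 ≤ l ∧ l ≤ L) ∧ ‖((α * ((M : ℝ) + l) : ℝ) : UnitAddCircle)‖ ≤ δ₁) :
    (#A : ℝ) * #(A.filter fun l : ℕ => (l - 1) / m = j) ≤
      #((Icc 1 (m * L)).filter fun l'' : ℕ =>
        ‖((α * ((((m + 1 : ℕ) : ℤ) * M + ((m * (j + 1) : ℕ) : ℤ) : ℤ) + l'') : ℝ) : UnitAddCircle)‖ ≤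
          2 * m * δ₁) := by
  classical
  set Aj := A.filter fun l : ℕ => (l - 1) / m = j with hAj
  have hδ₁ : ∀ l ∈ A, 0 ≤ δ₁ := fun l hl => (norm_nonneg _).trans (hA l hl).2
  -- elements of the block
  have hblock : ∀ l' ∈ Aj, j * m + 1 ≤ l' ∧ l' ≤ j * m + m := by
    intro l' hl'
    rw [hAj, mem_filter] at hl'
    obtain ⟨hl'A, hdiv⟩ := hl'
    have h1 := (hA l' hl'A).1.1
    have h3 := Nat.div_add_mod (l' - 1) m
    have h4 := Nat.mod_lt (l' - 1) (show 0 < m by omega)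
    rw [hdiv] at h3
    constructor
    · have : m * j ≤ l' - 1 := by omega
      rw [mul_comm] at this; omega
    · have : l' - 1 < m * j + m := by omega
      rw [mul_comm] at this; omega
  -- the map `(l, l') ↦ m(l-1) + (l' - jm)`
  set F : ℕ × ℕ → ℕ := fun p => m * (p.1 - 1) + (p.2 - j * m) with hF
  have hFinj : Set.InjOn F ↑(A ×ˢ Aj) := by
    rintro ⟨l₁, l₁'⟩ h₁ ⟨l₂, l₂'⟩ h₂ heq
    simp only [coe_product, Set.mem_prod, mem_coe] at h₁ h₂
    obtain ⟨b₁, c₁⟩ := hblock l₁' h₁.2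
    obtain ⟨b₂, c₂⟩ := hblock l₂' h₂.2
    have a₁ := (hA l₁ h₁.1).1.1
    have a₂ := (hA l₂ h₂.1).1.1
    simp only [hF] at heq
    -- compare quotient and remainder mod `m`
    have hr₁ : l₁' - j * m - 1 < m := by omega
    have hr₂ : l₂' - j * m - 1 < m := by omega
    have e₁ : m * (l₁ - 1) + (l₁' - j * m) = m * (l₁ - 1) + (l₁' - j * m - 1) + 1 := by omega
    have e₂ : m * (l₂ - 1) + (l₂' - j * m) = m * (l₂ - 1) + (l₂' - j * m - 1) + 1 := by omega
    have hq₁ : (m * (l₁ - 1) + (l₁' - j * m - 1)) / m = l₁ - 1 := by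
      rw [Nat.mul_add_div (by omega), Nat.div_eq_of_lt hr₁, add_zero]
    have hq₂ : (m * (l₂ - 1) + (l₂' - j * m - 1)) / m = l₂ - 1 := by
      rw [Nat.mul_add_div (by omega), Nat.div_eq_of_lt hr₂, add_zero]
    have hm₁ : (m * (l₁ - 1) + (l₁' - j * m - 1)) % m = l₁' - j * m - 1 := by
      rw [Nat.mul_add_mod, Nat.mod_eq_of_lt hr₁]
    have hm₂ : (m * (l₂ - 1) + (l₂' - j * m - 1)) % m = l₂' - j * m - 1 := by
      rw [Nat.mul_add_mod, Nat.mod_eq_of_lt hr₂]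
    have heq' : m * (l₁ - 1) + (l₁' - j * m - 1) = m * (l₂ - 1) + (l₂' - j * m - 1) := by omega
    have hl : l₁ - 1 = l₂ - 1 := by rw [← hq₁, ← hq₂, heq']
    have hl' : l₁' - j * m - 1 = l₂' - j * m - 1 := by rw [← hm₁, ← hm₂, heq']
    ext <;> simp only <;> omega
  -- the image lies in the good set
  have himg : (A ×ˢ Aj).image F ⊆ (Icc 1 (m * L)).filter fun l'' : ℕ =>
      ‖((α * ((((m + 1 : ℕ) : ℤ) * M + ((m * (j + 1) : ℕ) : ℤ) : ℤ) + l'') : ℝ) : UnitAddCircle)‖ ≤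
        2 * m * δ₁ := by
    intro x hx
    rw [mem_image] at hx
    obtain ⟨⟨l, l'⟩, hp, rfl⟩ := hx
    rw [mem_product] at hp
    obtain ⟨hl, hl'⟩ := hp
    have hl'A : l' ∈ A := (mem_filter.1 hl').1
    obtain ⟨b, c⟩ := hblock l' hl'
    obtain ⟨⟨a1, a2⟩, hn⟩ := hA l hl
    obtain ⟨⟨a1', a2'⟩, hn'⟩ := hA l' hl'A
    rw [mem_filter, mem_Icc]
    refine ⟨⟨by simp only [hF]; omega, ?_⟩, ?_⟩
    · simp only [hF]
      have : m * (l - 1) + m ≤ m * L := by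
        have : l - 1 + 1 ≤ L := by omega
        nlinarith
      omega
    · -- `α(M₀ + F(l,l')) = m·α(M+l) + α(M+l')`
      have hcast : ((F (l, l') : ℕ) : ℝ) = m * ((l : ℝ) - 1) + ((l' : ℝ) - j * m) := by
        simp only [hF]
        have h1 : ((l - 1 : ℕ) : ℝ) = (l : ℝ) - 1 := by push_cast [a1]; ring
        have h2 : ((l' - j * m : ℕ) : ℝ) = (l' : ℝ) - j * m := by
          have : j * m ≤ l' := by omega
          push_cast [this]; ring
        push_cast; rw [h1, h2]
      have e : ((α * ((((m + 1 : ℕ) : ℤ) * M + ((m * (j + 1) : ℕ) : ℤ) : ℤ) + (F (l, l') : ℕ)) : ℝ) :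
          UnitAddCircle) = (m : ℕ) • ((α * ((M : ℝ) + l) : ℝ) : UnitAddCircle) +
            ((α * ((M : ℝ) + l') : ℝ) : UnitAddCircle) := by
        rw [← AddCircle.coe_nsmul, ← AddCircle.coe_add]
        congr 1
        rw [hcast, nsmul_eq_mul]; push_cast; ring
      rw [e]
      calc ‖(m : ℕ) • ((α * ((M : ℝ) + l) : ℝ) : UnitAddCircle) + ((α * ((M : ℝ) + l') : ℝ) : UnitAddCircle)‖
          ≤ ‖(m : ℕ) • ((α * ((M : ℝ) + l) : ℝ) : UnitAddCircle)‖ + ‖((α * ((M : ℝ) + l') : ℝ) : UnitAddCircle)‖ :=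
            norm_add_le _ _
        _ ≤ m * δ₁ + δ₁ := add_le_add (norm_nsmul_le.trans
            (mul_le_mul_of_nonneg_left hn (Nat.cast_nonneg _))) hn'
        _ ≤ 2 * m * δ₁ := by
            have : (1 : ℝ) ≤ m := by exact_mod_cast hm
            have := hδ₁ l hl
            nlinarith
  calc (#A : ℝ) * #Aj = #(A ×ˢ Aj) := by rw [card_product]; push_cast; ring
    _ = #((A ×ˢ Aj).image F) := by rw [card_image_of_injOn hFinj]
    _ ≤ _ := by exact_mod_cast card_le_card himg

/-- **Recurrent linear functions are major arc, amplified (GT 2008b Lemma 32 (ii)).**  Let `α ∈ ℝ`,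
`M ∈ ℤ`, `0 < δ₂ ≤ 1`, `0 ≤ δ₁ ≤ δ₂/4`, `δ₂² L > 2`, and suppose that at least `δ₂ L` integers
`l ∈ {1, …, L}` satisfy `‖α(M+l)‖_{ℝ/ℤ} ≤ δ₁`.  Then there is `1 ≤ q ≤ 6418/δ₂²` with
`‖qα‖_{ℝ/ℤ} ≤ 2630455808 · δ₁/(δ₂⁶ L)`.
[cite: GreenTao2008QuadraticMobius, Lemma 32 (ii)] -/
theorem exists_norm_mul_le_of_many_small_amplified (α : ℝ) (M : ℤ) {L : ℕ} {δ₁ δ₂ : ℝ}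
    (hδ₂ : 0 < δ₂) (hδ₂1 : δ₂ ≤ 1) (hδ₁ : 0 ≤ δ₁) (hδ₁₂ : δ₁ ≤ δ₂ / 4) (hL : 2 < δ₂ ^ 2 * L)
    (hcount : δ₂ * L ≤ #((Icc 1 L).filter fun l : ℕ =>
      ‖((α * ((M : ℝ) + l) : ℝ) : UnitAddCircle)‖ ≤ δ₁)) :
    ∃ q : ℕ, 1 ≤ q ∧ (q : ℝ) ≤ 6418 / δ₂ ^ 2 ∧
      ‖((((q : ℝ) * α : ℝ)) : UnitAddCircle)‖ ≤ 2630455808 * δ₁ / (δ₂ ^ 6 * L) := by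
  classical
  have hδ₂sq : δ₂ ^ 2 ≤ δ₂ := by nlinarith
  have hδ₂6 : δ₂ ^ 6 ≤ δ₂ ^ 2 := by nlinarith [pow_le_one₀ hδ₂.le hδ₂1 (n := 4), pow_nonneg hδ₂.le 2]
  have hδ₂6' : δ₂ ^ 6 ≤ δ₂ ^ 4 := by nlinarith [pow_le_one₀ hδ₂.le hδ₂1 (n := 2), pow_nonneg hδ₂.le 4]
  have hδ₂6pos : 0 < δ₂ ^ 6 := by positivity
  have hLpos : (0 : ℝ) < L := by
    by_contra h
    push Not at h
    have : δ₂ ^ 2 * L ≤ 0 := mul_nonpos_of_nonneg_of_nonpos (by positivity) h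
    linarith
  have hL1 : 1 ≤ L := by exact_mod_cast (show (0 : ℝ) < L from hLpos)
  have hδ₂L : 2 ≤ δ₂ * L := by nlinarith
  set A := (Icc 1 L).filter fun l : ℕ => ‖((α * ((M : ℝ) + l) : ℝ) : UnitAddCircle)‖ ≤ δ₁ with hAdef
  have hA : ∀ l ∈ A, (1 ≤ l ∧ l ≤ L) ∧ ‖((α * ((M : ℝ) + l) : ℝ) : UnitAddCircle)‖ ≤ δ₁ := by
    intro l hl; rw [hAdef, mem_filter, mem_Icc] at hl; exact hl
  -- regime (a): `δ₁ ≥ δ₂²/64` — part (i) directly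
  by_cases ha : δ₂ ^ 2 / 64 ≤ δ₁
  · obtain ⟨q, hq1, hqle, hqα⟩ := exists_norm_mul_le_of_many_small α M hL1 hδ₂ hδ₂1 hδ₁ hδ₁₂ hcount
    refine ⟨q, hq1, hqle.trans ?_, hqα.trans ?_⟩
    · rw [div_le_div_iff₀ hδ₂ (by positivity)]; nlinarith
    · rw [div_le_div_iff₀ (by positivity) (by positivity)]
      have h1 : δ₂ ^ 2 ≤ 64 * δ₁ := by linarith
      have h4 : δ₂ ^ 4 ≤ 1 := pow_le_one₀ hδ₂.le hδ₂1
      have h3 : δ₂ ^ 2 * (δ₂ ^ 2 * L) ≤ 64 * δ₁ * (δ₂ ^ 2 * L) :=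
        mul_le_mul_of_nonneg_right h1 (by positivity)
      have h5 : δ₂ ^ 4 * (δ₂ ^ 2 * L) ≤ 1 * (δ₂ ^ 2 * L) :=
        mul_le_mul_of_nonneg_right h4 (by positivity)
      have e1 : 10275218 * (δ₂ ^ 6 * (L : ℝ)) = 10275218 * (δ₂ ^ 4 * (δ₂ ^ 2 * L)) := by ring
      have e2 : 2630455808 * δ₁ * (δ₂ ^ 2 * (L : ℝ)) = 41100872 * (64 * δ₁ * (δ₂ ^ 2 * L)) := by ring
      rw [e1, e2]
      have h6 : δ₂ ^ 2 * (L : ℝ) ≤ δ₂ ^ 2 * (δ₂ ^ 2 * L) + (δ₂ ^ 2 * L - δ₂ ^ 2 * (δ₂ ^ 2 * L)) := by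
        linarith
      have h7 : 0 ≤ δ₂ ^ 2 * (L : ℝ) := by positivity
      nlinarith [h3, h5, h7]
  push Not at ha
  -- regime (c): `δ₁ ≤ 1/(8L)` — the fine-scale lattice argument
  by_cases hc : 8 * δ₁ * L ≤ 1
  · obtain ⟨q, hq1, hqle, hqα⟩ := exists_norm_mul_le_of_many_tiny α M hδ₂ (by linarith) hδ₂L hcount
    refine ⟨q, hq1, hqle.trans ?_, hqα.trans ?_⟩
    · rw [div_le_div_iff₀ hδ₂ (by positivity)]; nlinarith
    · rw [div_le_div_iff₀ (by positivity) (by positivity)]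
      have h6 : δ₂ ^ 6 ≤ δ₂ := pow_le_of_le_one hδ₂.le hδ₂1 (by norm_num)
      have h7 : δ₁ * L * δ₂ ^ 6 ≤ δ₁ * L * δ₂ :=
        mul_le_mul_of_nonneg_left h6 (mul_nonneg hδ₁ hLpos.le)
      have h8 : 0 ≤ δ₁ * L * δ₂ := mul_nonneg (mul_nonneg hδ₁ hLpos.le) hδ₂.le
      have e1 : 4 * δ₁ * (δ₂ ^ 6 * (L : ℝ)) = 4 * (δ₁ * L * δ₂ ^ 6) := by ring
      have e2 : 2630455808 * δ₁ * (δ₂ * (L : ℝ)) = 2630455808 * (δ₁ * L * δ₂) := by ring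
      rw [e1, e2]
      linarith
  push Not at hc
  -- regime (b): amplification with block length `m = ⌊δ₂²/(32 δ₁)⌋`
  have hδ₁pos : 0 < δ₁ := by
    by_contra h; push Not at h
    have : 8 * δ₁ * L ≤ 0 := by nlinarith
    linarith
  set m : ℕ := ⌊δ₂ ^ 2 / (32 * δ₁)⌋₊ with hmdef
  have hmle : (m : ℝ) ≤ δ₂ ^ 2 / (32 * δ₁) := Nat.floor_le (by positivity)
  have hmgt : δ₂ ^ 2 / (32 * δ₁) < m + 1 := Nat.lt_floor_add_one _
  have hratio : 2 < δ₂ ^ 2 / (32 * δ₁) := by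
    rw [lt_div_iff₀ (by positivity)]; nlinarith
  have hm2 : 2 ≤ m := by
    have : (1 : ℝ) < m := by linarith
    have : 1 < m := by exact_mod_cast this
    omega
  have hm1 : 1 ≤ m := by omega
  have hmpos : (0 : ℝ) < m := by exact_mod_cast (show 0 < m by omega)
  have hmL : m ≤ L := by
    have h1 : (m : ℝ) ≤ δ₂ ^ 2 / (32 * δ₁) := hmle
    have h2 : δ₂ ^ 2 / (32 * δ₁) ≤ L := by
      rw [div_le_iff₀ (by positivity)]
      have : δ₂ ^ 2 ≤ 1 := by nlinarith
      nlinarith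
    exact_mod_cast h1.trans h2
  have hmge : δ₂ ^ 2 / (64 * δ₁) ≤ m := by
    have : δ₂ ^ 2 / (64 * δ₁) = δ₂ ^ 2 / (32 * δ₁) / 2 := by
      field_simp; ring
    rw [this]; linarith
  -- dense block
  obtain ⟨j, hj⟩ := exists_dense_block hm1 hmL A (fun l hl => by
    rw [mem_Icc]; exact (hA l hl).1)
  set Aj := A.filter fun l : ℕ => (l - 1) / m = j with hAjdef
  have hAj : δ₂ * m / 2 ≤ #Aj := by
    refine le_trans ?_ hj
    rw [div_le_div_iff₀ (by norm_num) (by positivity)]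
    have : δ₂ * L ≤ #A := hcount
    nlinarith
  -- the amplified count
  have hamp := card_filter_amplified_ge α M hm1 j A hA
  set M₀ : ℤ := ((m + 1 : ℕ) : ℤ) * M + ((m * (j + 1) : ℕ) : ℤ) with hM₀
  have hcount' : δ₂ ^ 2 / 2 * ((m * L : ℕ) : ℝ) ≤ #((Icc 1 (m * L)).filter fun l'' : ℕ =>
      ‖((α * ((M₀ : ℝ) + l'') : ℝ) : UnitAddCircle)‖ ≤ 2 * m * δ₁) := by
    refine le_trans ?_ hamp
    have h1 : δ₂ * L ≤ #A := hcount
    push_cast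
    calc δ₂ ^ 2 / 2 * ((m : ℝ) * L) = (δ₂ * L) * (δ₂ * m / 2) := by ring
      _ ≤ #A * #Aj := mul_le_mul h1 hAj (by positivity) (Nat.cast_nonneg _)
  -- apply part (i) on the amplified interval
  have hmL1 : 1 ≤ m * L := Nat.one_le_iff_ne_zero.2 (Nat.mul_ne_zero (by omega) (by omega))
  have hδ₂' : 0 < δ₂ ^ 2 / 2 := by positivity
  have hδ₂'1 : δ₂ ^ 2 / 2 ≤ 1 := by nlinarith
  have hδ₁' : 0 ≤ 2 * m * δ₁ := by positivity
  have hδ₁'₂ : 2 * m * δ₁ ≤ δ₂ ^ 2 / 2 / 4 := by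
    have : (m : ℝ) * (32 * δ₁) ≤ δ₂ ^ 2 := (le_div_iff₀ (by positivity)).1 hmle
    linarith
  obtain ⟨q, hq1, hqle, hqα⟩ :=
    exists_norm_mul_le_of_many_small α M₀ hmL1 hδ₂' hδ₂'1 hδ₁' hδ₁'₂ hcount'
  refine ⟨q, hq1, hqle.trans ?_, hqα.trans ?_⟩
  · rw [div_div_eq_mul_div, div_le_div_iff₀ (by positivity) (by positivity)]; nlinarith
  · -- `10275218/((δ₂²/2)² · mL) = 41100872/(δ₂⁴ m L) ≤ 41100872·64 δ₁/(δ₂⁶ L)`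
    have hmL' : ((m * L : ℕ) : ℝ) = (m : ℝ) * L := by push_cast; ring
    rw [hmL']
    rw [div_le_div_iff₀ (by positivity) (by positivity)]
    -- need: 10275218 · δ₂⁶ L ≤ 2630455808 δ₁ · ((δ₂²/2)² · m L)
    have h1 : δ₂ ^ 2 ≤ 64 * δ₁ * m := by
      have := (div_le_iff₀ (by positivity : (0 : ℝ) < 64 * δ₁)).1 hmge; linarith
    have h3 : δ₂ ^ 2 * (δ₂ ^ 4 * L) ≤ (64 * δ₁ * m) * (δ₂ ^ 4 * L) :=
      mul_le_mul_of_nonneg_right h1 (by positivity)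
    have e1 : 10275218 * (δ₂ ^ 6 * (L : ℝ)) = 10275218 * (δ₂ ^ 2 * (δ₂ ^ 4 * L)) := by ring
    have e2 : 2630455808 * δ₁ * ((δ₂ ^ 2 / 2) ^ 2 * ((m : ℝ) * L)) =
        10275218 * ((64 * δ₁ * m) * (δ₂ ^ 4 * L)) := by ring
    rw [e1, e2]
    linarith

end Summit.Parity.GeneralizedHardyLittlewood.GreenTaoLevelTwoMNTwoRecurrentLinearAmplified
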